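import Mathlib
import Literature.Computability.AlgebraicComplexity.AsymptoticSpectrum
import Literature.Computability.AlgebraicComplexity.TensorRestrictionRank
import Literature.Computability.AlgebraicComplexity.KroneckerRank
import Literature.Computability.AlgebraicComplexity.CoppersmithWinograd1990Proofs
import Literature.Barriers.MatrixMultiplication.IrreversibilityBarrierProofs
import Summits.MatrixMultiplication.MatrixMultiplication.Theorems.OutsiderSandwichHalfMMDiagonal
import Summits.MatrixMultiplication.MatrixMultiplication.Theorems.OutsiderSandwichHalfMMFinite
import Summits.MatrixMultiplication.MatrixMultiplication.Theorems.OutsiderSandwichDegenerationWitnessRestrictions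

/-!
# OutsiderSandwich — assisted cells, PART 1 of 2 (route-free core: restrictions, rank price, rate)

LANDING SPLIT (decomp-mm-lander-1 g1, 2026-08-30; mechanical, 400-line lint, at «end Rate» per the writer) of the lens-4
gen-8 landing form `OutsiderSandwichAssisted.lean` (sha256 `52ddd361…4182`, 583 l.; critic-CLEARED decomp-mm STATUS l.372;
REQUESTS #17): source lines 61–424 byte-identical EXCEPT one tree-demanded rename: the landed helper
`Theorems.OutsiderSandwichHalfMMDiagonal` spells the diagonal statement out in its theorem `diagonalAchieved` and declares
no `def DiagonalAchieved`, so the binder `(hD : DiagonalAchieved)` of `rate_of_assisted` is δ-unfolded to that literal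
statement (same proposition; proof untouched); and the gate-forced dedup.landed edits: the relabelling lemmas
`cwPow_add_restrictsTo`/`mm_mul`/`mm_pow` and `kronecker_shuffle`/`unitTensor_mul_restrictsTo` are IMPORTED from the landed
helpers `…OutsiderSandwichDegenerationWitnessRestrictions` / `…OutsiderSandwichHalfMMFinite` instead of copied, while
`kronecker_matMul_restrictsTo`, `tensorRank_cwTensor_two_le_four'`, `tensorRank_cwPow_le` (landed twins not importable here:
route-importing module / no farm olean) became local `have`s (same statements, same proofs) in `assisted_pow` /
`tensorRank_matMul_le_of_assisted`.  Imports NO `Theses` file (lint `theses-cone`).  PART 2 =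
`Theorems/OutsiderSandwichAssisted.lean` (asides 31282–31285 BY NAME).  Supports `stmt-MatrixMultiplication-31282`; nothing
here proves ω = 2.
-/

set_option linter.dupNamespace false

namespace Summit.MatrixMultiplication.MatrixMultiplication.Theorems.OutsiderSandwichAssisted

open scoped BigOperators
open Complex
open Literature.Computability.AlgebraicComplexity
open Summit.MatrixMultiplication.MatrixMultiplication.Theorems.OutsiderSandwichHalfMM
  (diagonalAchieved kronecker_shuffle unitTensor_mul_restrictsTo)
-- relabelling lemmas shared with the landed degeneration-witness helper (gate dedup.landed ⇒ imported, not copied)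
open Summit.MatrixMultiplication.MatrixMultiplication.Theorems.OutsiderSandwichDegenerationWitness
  (cwPow_add_restrictsTo mm_mul mm_pow)

/-! ## Restriction plumbing (relabellings) -/

section Restrictions

/-- `t ≥ t ⊠ ⟨1⟩` (relabelling `(a, 0) ↦ a`). [folklore] -/
theorem restrictsTo_kronecker_unitOne {ι κ μ : Type} [Fintype ι] [Fintype κ] [Fintype μ]
    [DecidableEq ι] [DecidableEq κ] [DecidableEq μ] (t : ι → κ → μ → ℂ) :
    TensorRestrictsTo t (kroneckerTensor t (unitTensor ℂ 1)) := by
  have e : kroneckerTensor t (unitTensor ℂ 1) = fun a b c => t a.1 b.1 c.1 := by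
    funext a b c
    simp [kroneckerTensor_apply, unitTensor_apply, Subsingleton.elim a.2 b.2, Subsingleton.elim b.2 c.2]
  rw [e]
  exact tensorRestrictsTo_precomp _ _ _ _

/-- `t ⊠ ⟨1⟩ ≥ t` (relabelling `a ↦ (a, 0)`). [folklore] -/
theorem kronecker_unitOne_restrictsTo {ι κ μ : Type} [Fintype ι] [Fintype κ] [Fintype μ]
    [DecidableEq ι] [DecidableEq κ] [DecidableEq μ] (t : ι → κ → μ → ℂ) :
    TensorRestrictsTo (kroneckerTensor t (unitTensor ℂ 1)) t := by
  have e : kroneckerTensor t (unitTensor ℂ 1) = fun a b c =>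
      t (Equiv.prodUnique ι (Fin 1) a) (Equiv.prodUnique κ (Fin 1) b)
        (Equiv.prodUnique μ (Fin 1) c) := by
    funext a b c
    simp [kroneckerTensor_apply, unitTensor_apply, Subsingleton.elim a.2 b.2, Subsingleton.elim b.2 c.2]
  rw [e]
  exact tensorRestrictsTo_of_reindex t _ _ _

/-- The trivial cell `cw₂^{⊠N} ≥ ⟨1,1,1⟩` (the entry of `cw₂^{⊠N}` at `(0…0, 2…2, 2…2)` is `1`).
[folklore] -/
theorem cwPow_restrictsTo_mmOne (N : ℕ) :
    TensorRestrictsTo (kroneckerPow (cwTensor ℂ 2) N) (matMulTensor ℂ 1 1 1) := by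
  classical
  have h2 : (Fin.last 2 : Fin 3) ≠ 0 := by decide
  have e : matMulTensor ℂ 1 1 1 = fun (a : Fin 1 × Fin 1) (b : Fin 1 × Fin 1) (c : Fin 1 × Fin 1) =>
      kroneckerPow (cwTensor ℂ 2) N ((fun _ _ => (0 : Fin 3)) a) ((fun _ _ => Fin.last 2) b)
        ((fun _ _ => Fin.last 2) c) := by
    funext a b c
    simp only [kroneckerPow_apply, cwTensor_zero_left ℂ 2 h2, Finset.prod_const_one]
    simp [matMulTensor, Subsingleton.elim a.1 b.1, Subsingleton.elim b.2 c.1, Subsingleton.elim a.2 c.2]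
  rw [e]
  exact tensorRestrictsTo_precomp _ _ _ _

/-- **Powers of an assisted cell**: `⟨m,m,m⟩ ≤ cw₂^{⊠N} ⊠ ⟨r⟩ ⟹ ⟨m^{k+1}⟩³ ≤ cw₂^{⊠N(k+1)} ⊠ ⟨r^{k+1}⟩`
(Kronecker powers of the restriction, middle-four interchange, `⟨r⟩^{⊠k} ≅ ⟨r^k⟩`). [new] -/
theorem assisted_pow {N m r : ℕ}
    (hA : TensorRestrictsTo (kroneckerTensor (kroneckerPow (cwTensor ℂ 2) N) (unitTensor ℂ r))
      (matMulTensor ℂ m m m)) (k : ℕ) :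
    TensorRestrictsTo
      (kroneckerTensor (kroneckerPow (cwTensor ℂ 2) (N * (k + 1))) (unitTensor ℂ (r ^ (k + 1))))
      (matMulTensor ℂ (m ^ (k + 1)) (m ^ (k + 1)) (m ^ (k + 1))) := by
  -- `⟨m,m,m⟩ ⊗ ⟨m',m',m'⟩ ≥ ⟨mm',mm',mm'⟩` (double-index relabelling) [cite: Blaser2013, §5.2 p. 24] — a local copy:
  -- the identical lemma is LANDED as `Theorems.OutsiderSandwichPackingProfile.matMul_kronecker_matMul_restrictsTo`
  -- (gate dedup.landed), whose module imports the route file and is therefore not imported into this route-free helper.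
  have kronecker_matMul_restrictsTo : ∀ m m' : ℕ,
      TensorRestrictsTo (kroneckerTensor (matMulTensor ℂ m m m) (matMulTensor ℂ m' m' m'))
        (matMulTensor ℂ (m * m') (m * m') (m * m')) := by
    intro m m'
    have e : kroneckerTensor (matMulTensor ℂ m m m) (matMulTensor ℂ m' m' m') = fun a b c =>
        matMulTensor ℂ (m * m') (m * m') (m * m') (doubleIndexEquiv m m m' m' a)
          (doubleIndexEquiv m m m' m' b) (doubleIndexEquiv m m m' m' c) := by
      funext a b c
      exact kroneckerTensor_matMulTensor (K := ℂ) m m m m' m' m' a b c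
    rw [e]
    exact tensorRestrictsTo_of_reindex (matMulTensor ℂ _ _ _) _ _ _
  induction k with
  | zero =>
      rw [Nat.zero_add, Nat.mul_one, pow_one, pow_one]
      exact hA
  | succ k ih =>
      have h := (((cwPow_add_restrictsTo (N * (k + 1)) N).kronecker
          (unitTensor_mul_restrictsTo (r ^ (k + 1)) r)).trans
        ((kronecker_shuffle _ _ _ _).trans
          ((ih.kronecker hA).trans (kronecker_matMul_restrictsTo (m ^ (k + 1)) m))))
      have e1 : N * (k + 1 + 1) = N * (k + 1) + N := by ring
      rw [e1, pow_succ r (k + 1), pow_succ m (k + 1)]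
      exact h

/-- **Honest cell from an assisted cell plus a diagonal**: `⟨m,m,m⟩ ≤ cw₂^{⊠N} ⊠ ⟨r⟩` and
`⟨r'⟩ ≤ cw₂^{⊠N'}` with `r ≤ r'` give `⟨m,m,m⟩ ≤ cw₂^{⊠(N+N')}`. [new] -/
theorem honest_of_assisted {N m r N' r' : ℕ}
    (hA : TensorRestrictsTo (kroneckerTensor (kroneckerPow (cwTensor ℂ 2) N) (unitTensor ℂ r))
      (matMulTensor ℂ m m m))
    (hD : TensorRestrictsTo (kroneckerPow (cwTensor ℂ 2) N') (unitTensor ℂ r')) (hr : r ≤ r') :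
    TensorRestrictsTo (kroneckerPow (cwTensor ℂ 2) (N + N')) (matMulTensor ℂ m m m) := by
  classical
  exact (cwPow_add_restrictsTo N N').trans
    (((TensorRestrictsTo.refl _).kronecker (hD.trans (tensorRestrictsTo_unitTensor_castLE hr))).trans hA)

end Restrictions

/-! ## The rank price of a cell: `R(cw₂) ≤ 4`, `R(cw₂^{⊠N} ⊠ ⟨r⟩) ≤ 4^N·r` -/

section RankPrice

/-- **Rank price of an assisted cell**: `⟨m,m,m⟩ ≤ cw₂^{⊠N} ⊠ ⟨r⟩ ⟹ R(⟨m,m,m⟩) ≤ 4^N · r`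
(rank is restriction-monotone and submultiplicative; `R(cw₂) ≤ 4`, `R(⟨r⟩) ≤ r`).
[cite: Blaser2013, Lemma 5.4 and 5.8] -/
theorem tensorRank_matMul_le_of_assisted {N m r : ℕ}
    (hA : TensorRestrictsTo (kroneckerTensor (kroneckerPow (cwTensor ℂ 2) N) (unitTensor ℂ r))
      (matMulTensor ℂ m m m)) :
    tensorRank (matMulTensor ℂ m m m) ≤ 4 ^ N * r := by
  -- Local copies (gate dedup.landed; the landed twins `Theorems.tensorRank_cwTensor_two_le_four`
  -- [SoloInformedCwTwoPattern] and `Theorems.tensorRank_kroneckerPow_cwTensor_two_le_four_pow`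
  -- [SoloBlindAbelianRealization] have no farm olean, so they cannot be imported):
  -- **`R(T_{cw,2}) ≤ 4` over `ℂ`**, the point `s = (1,1,1)` of the Conner–Huang–Landsberg torus family,
  -- `8·cw₂ = (1,2,0)^{⊗3} − (1,0,2i)^{⊗3} − (1,0,−2i)^{⊗3} + (1,−2,0)^{⊗3}` [cite: ConnerHuangLandsberg2020, §1],
  have tensorRank_cwTensor_two_le_four' : tensorRank (cwTensor ℂ 2) ≤ 4 := by
    refine tensorRank_le_of_eq_sum
      (fun e a => (![1 / 8, -1 / 8, -1 / 8, 1 / 8] : Fin 4 → ℂ) e *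
        (![![1, 2, 0], ![1, 0, 2 * I], ![1, 0, -2 * I], ![1, -2, 0]] : Fin 4 → Fin 3 → ℂ) e a)
      (![![1, 2, 0], ![1, 0, 2 * I], ![1, 0, -2 * I], ![1, -2, 0]] : Fin 4 → Fin 3 → ℂ)
      (![![1, 2, 0], ![1, 0, 2 * I], ![1, 0, -2 * I], ![1, -2, 0]] : Fin 4 → Fin 3 → ℂ) ?_
    funext a b c
    simp only [Finset.sum_apply, Fin.sum_univ_four, triad_apply, cwTensor_apply]
    fin_cases a <;> fin_cases b <;> fin_cases c <;> simp <;>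
      first
        | ring1
        | linear_combination Complex.I_sq
  -- and `R(cw₂^{⊠N}) ≤ 4^N` (submultiplicativity) [cite: Blaser2013, Lemma 5.8].
  have tensorRank_cwPow_le : ∀ N : ℕ, tensorRank (kroneckerPow (cwTensor ℂ 2) N) ≤ 4 ^ N := by
    intro N
    have h1 : tensorRank (kroneckerPow (cwTensor ℂ 2) 1) ≤ 4 := by
      have e : kroneckerPow (cwTensor ℂ 2) 1 = fun a b c => cwTensor ℂ 2 (a 0) (b 0) (c 0) := by
        funext a b c
        simp [kroneckerPow_apply]
      rw [e]
      exact (tensorRank_precomp_le _ _ _ _).trans tensorRank_cwTensor_two_le_four'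
    have h := tensorRank_kroneckerPow_mul_le_pow (cwTensor ℂ 2) 1 N
    rw [one_mul] at h
    exact h.trans (Nat.pow_le_pow_left h1 N)
  exact hA.tensorRank_le.trans ((Blaser2013_lemma58 _ _).trans
    (Nat.mul_le_mul (tensorRank_cwPow_le N)
      (Literature.Barriers.MatrixMultiplication.tensorRank_unitTensor_le r)))

end RankPrice

/-! ## One assisted cell gives honest rate rungs for every `c < ρ(N,m,r) = (m²)^{1/(N+log₃ r)}` -/

section Rate

/-- The real-arithmetic core of `rate_of_assisted` (branch `r ≥ 2`): with `L = log₃ r > 0`,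
`Lc = log c > 0` and the gap `g = 2 log m − (N+L) log c > 0`, there are a slack `ε ∈ (0, 1/2]` for
the diagonal and a threshold `B` such that every diagonal level `N'' ≥ B` whose size exponent obeys
`(1-ε) N'' < (K+1) L` (i.e. `r^{K+1} > r'' ≥ 3^{(1-ε)N''}`) has `K ≥ 1` and pays off:
`N''·log c ≤ K·L·log c + K·g`. [new] -/
theorem rate_core {L Lc g : ℝ} (hL : 0 < L) (hLc : 0 < Lc) (hg : 0 < g) :
    ∃ ε : ℝ, 0 < ε ∧ ε ≤ 1 / 2 ∧ ∃ B : ℝ, ∀ N'' K : ℝ, 0 ≤ K → B ≤ N'' →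
      (1 - ε) * N'' < (K + 1) * L → 1 ≤ K ∧ N'' * Lc ≤ K * L * Lc + K * g := by
  have hLLc : 0 < L * Lc := mul_pos hL hLc
  refine ⟨min (1 / 2) (g / (8 * (L * Lc))), lt_min (by norm_num) (by positivity), min_le_left _ _,
    2 * L * (2 * (L * Lc) / g + 2), fun N'' K hK hB hlt => ?_⟩
  set ε : ℝ := min (1 / 2) (g / (8 * (L * Lc))) with hεdef
  have hε0 : 0 < ε := lt_min (by norm_num) (by positivity)
  have hε2 : ε ≤ 1 / 2 := min_le_left _ _
  have hεg : ε * (8 * (L * Lc)) ≤ g := by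
    have := min_le_right (1 / 2 : ℝ) (g / (8 * (L * Lc)))
    rwa [← hεdef, le_div_iff₀ (by positivity)] at this
  set M : ℝ := 2 * (L * Lc) / g with hMdef
  have hMg : M * g = 2 * (L * Lc) := by rw [hMdef]; exact div_mul_cancel₀ _ hg.ne'
  have hM0 : 0 ≤ M := by positivity
  have hN''0 : 0 ≤ N'' := le_trans (by positivity) hB
  -- `N''/2 ≤ (1-ε) N'' < (K+1) L`
  have h1 : N'' ≤ 2 * ((K + 1) * L) := by
    nlinarith [mul_nonneg (sub_nonneg.2 hε2) hN''0]
  -- `K + 1 > N''/(2L) ≥ B/(2L) = M + 2`, so `K > M + 1 ≥ 1` and `K g ≥ 2 L Lc + g`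
  have h2 : (M + 2) * L ≤ (K + 1) * L := by nlinarith
  have hK2 : M + 2 ≤ K + 1 := le_of_mul_le_mul_right h2 hL
  have hK1 : 1 ≤ K := by linarith
  have hKg : 2 * (L * Lc) + g ≤ K * g := by nlinarith
  refine ⟨hK1, ?_⟩
  -- `ε N'' Lc ≤ 2 ε (K+1) L Lc ≤ (K+1) g / 4`
  have hA1 : ε * N'' * Lc ≤ ε * (2 * ((K + 1) * L)) * Lc :=
    mul_le_mul_of_nonneg_right (mul_le_mul_of_nonneg_left h1 hε0.le) hLc.le
  have hA2 : ε * (2 * ((K + 1) * L)) * Lc ≤ (K + 1) * g / 4 := by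
    have := mul_le_mul_of_nonneg_left hεg (by positivity : (0 : ℝ) ≤ (K + 1) / 4)
    nlinarith
  have hA3 : (1 - ε) * N'' * Lc < (K + 1) * L * Lc := mul_lt_mul_of_pos_right hlt hLc
  nlinarith

/-- **ω-free rate rung from ONE assisted cell.**  If `⟨m,m,m⟩ ≤ cw₂^{⊠N} ⊠ ⟨r⟩` (`N, r ≥ 1`) and
`0 ≤ c` has `c^{N + log₃ r} < m²` — i.e. `c` is below the cell's rate `ρ = (m²)^{1/(N+log₃ r)}` — then
for every `N₀` there are `N' ≥ N₀` and `m'` with `⟨m',m',m'⟩ ≤ cw₂^{⊠N'}` and `c^{N'} ≤ m'²`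
(`CwTwoRate c`).  Mechanism: `K` Kronecker powers of the cell need the catalyst `⟨r^K⟩`, which the
kernel diagonal `Q̃(cw₂) = 3` (`hD`, PROVED as `diagonalAchieved`) supplies from `N'' ≈ K·log₃ r`
further copies; `K` is ADAPTED to the diagonal level (`r^K ≤ r'' < r^{K+1}`), so only cofinality of
the diagonal is used. [new] -/
theorem rate_of_assisted
    (hD : ∀ ε : ℝ, 0 < ε → ∀ N₀ : ℕ, ∃ N : ℕ, N₀ ≤ N ∧ ∃ r : ℕ,
      TensorRestrictsTo (kroneckerPow (cwTensor ℂ 2) N) (unitTensor ℂ r) ∧ (3 : ℝ) ^ ((1 - ε) * N) ≤ (r : ℝ))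
    {N m r : ℕ} (hN : 1 ≤ N) (hr : 1 ≤ r)
    (hA : TensorRestrictsTo (kroneckerTensor (kroneckerPow (cwTensor ℂ 2) N) (unitTensor ℂ r))
      (matMulTensor ℂ m m m))
    {c : ℝ} (hc0 : 0 ≤ c) (hc : c ^ ((N : ℝ) + Real.logb 3 r) < (m : ℝ) ^ 2) (N₀ : ℕ) :
    ∃ N' : ℕ, N₀ ≤ N' ∧ ∃ m' : ℕ,
      TensorRestrictsTo (kroneckerPow (cwTensor ℂ 2) N') (matMulTensor ℂ m' m' m') ∧
        c ^ N' ≤ (m' : ℝ) ^ 2 := by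
  classical
  rcases le_or_gt c 1 with hc1 | hc1
  · -- `c ≤ 1`: the trivial cells `⟨1,1,1⟩ ≤ cw₂^{⊠N₀}` do
    refine ⟨N₀, le_rfl, 1, cwPow_restrictsTo_mmOne N₀, ?_⟩
    rw [Nat.cast_one, one_pow]
    exact pow_le_one₀ hc0 hc1
  have hcpos : 0 < c := lt_trans one_pos hc1
  have hLc : 0 < Real.log c := Real.log_pos hc1
  have hx0 : 0 ≤ Real.logb 3 (r : ℝ) :=
    Real.logb_nonneg (by norm_num) (by exact_mod_cast hr)
  -- `m ≥ 2` (else `m² ≤ 1 < c^x`)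
  have hm2 : 2 ≤ m := by
    by_contra hm
    have hm1 : (m : ℝ) ≤ 1 := by exact_mod_cast (by omega : m ≤ 1)
    have h1 : (1 : ℝ) ≤ c ^ ((N : ℝ) + Real.logb 3 r) :=
      Real.one_le_rpow hc1.le (by positivity)
    have hm0 : (0 : ℝ) ≤ m := Nat.cast_nonneg (α := ℝ) m
    have h2 : (m : ℝ) ^ 2 ≤ 1 := by nlinarith
    linarith
  have hm1 : (1 : ℝ) < m := by exact_mod_cast (by omega : 1 < m)
  have hmpos : (0 : ℝ) < m := by positivity
  have hLm : 0 < Real.log m := Real.log_pos hm1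
  rcases eq_or_lt_of_le hr with rfl | hr2
  · -- `r = 1`: an honest cell; its powers suffice
    have hI : TensorRestrictsTo (kroneckerPow (cwTensor ℂ 2) N) (matMulTensor ℂ m m m) :=
      (restrictsTo_kronecker_unitOne _).trans hA
    have hc' : c ^ N < (m : ℝ) ^ 2 := by
      have := hc
      rw [Nat.cast_one, Real.logb_one, add_zero, Real.rpow_natCast] at this
      exact this
    refine ⟨N * (N₀ + 1), ?_, m ^ (N₀ + 1), mm_pow hI N₀, ?_⟩
    · calc N₀ ≤ N₀ + 1 := Nat.le_succ _
        _ ≤ N * (N₀ + 1) := Nat.le_mul_of_pos_left _ hN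
    · have e1 : c ^ (N * (N₀ + 1)) = (c ^ N) ^ (N₀ + 1) := pow_mul c N (N₀ + 1)
      have e2 : (((m ^ (N₀ + 1) : ℕ) : ℝ)) ^ 2 = ((m : ℝ) ^ 2) ^ (N₀ + 1) := by
        push_cast
        ring
      rw [e1, e2]
      exact pow_le_pow_left₀ (pow_nonneg hc0 N) hc'.le _
  -- `r ≥ 2`
  have hr1 : (1 : ℝ) < r := by exact_mod_cast hr2
  have hrpos : (0 : ℝ) < r := by positivity
  have hLr : 0 < Real.log r := Real.log_pos hr1
  have hL3 : 0 < Real.log 3 := Real.log_pos (by norm_num)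
  set L : ℝ := Real.logb 3 (r : ℝ) with hLdef
  have hLdiv : L = Real.log r / Real.log 3 := rfl
  have hL : 0 < L := div_pos hLr hL3
  have hLL3 : L * Real.log 3 = Real.log r := div_mul_cancel₀ _ hL3.ne'
  -- the gap
  have hgap : ((N : ℝ) + L) * Real.log c < 2 * Real.log m := by
    have h1 := Real.log_lt_log (Real.rpow_pos_of_pos hcpos _) hc
    rwa [Real.log_rpow hcpos, Real.log_pow, Nat.cast_ofNat] at h1
  set g : ℝ := 2 * Real.log m - ((N : ℝ) + L) * Real.log c with hgdef
  have hg : 0 < g := by rw [hgdef]; linarith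
  obtain ⟨ε, hε0, hε2, B, hcore⟩ := rate_core hL hLc hg
  -- the diagonal, at slack `ε`, beyond `max N₀ ⌈B⌉₊`
  obtain ⟨N'', hN''ge, r'', hDres, hDsize⟩ := hD ε hε0 (max N₀ ⌈B⌉₊)
  have hN''N₀ : N₀ ≤ N'' := le_of_max_le_left hN''ge
  have hN''B : B ≤ (N'' : ℝ) :=
    (Nat.le_ceil B).trans (by exact_mod_cast le_of_max_le_right hN''ge)
  have hr''pos : (0 : ℝ) < r'' := lt_of_lt_of_le (Real.rpow_pos_of_pos (by norm_num) _) hDsize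
  have hr''ne : r'' ≠ 0 := by
    rintro rfl
    simp at hr''pos
  -- `K := ⌊log_r r''⌋`: `r^K ≤ r'' < r^{K+1}`
  set K : ℕ := Nat.log r r'' with hKdef
  have hKle : r ^ K ≤ r'' := Nat.pow_log_le_self r hr''ne
  have hKlt : r'' < r ^ (K + 1) := Nat.lt_pow_succ_log_self hr2 r''
  -- `(1-ε) N'' < (K+1) L` in logs
  have hlog1 : (1 - ε) * N'' * Real.log 3 ≤ Real.log r'' := by
    have h1 := Real.log_le_log (Real.rpow_pos_of_pos (by norm_num) _) hDsize
    rwa [Real.log_rpow (by norm_num)] at h1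
  have hlog2 : Real.log r'' < (K + 1) * Real.log r := by
    have h1 : (r'' : ℝ) < (r : ℝ) ^ (K + 1) := by exact_mod_cast hKlt
    have h2 := Real.log_lt_log hr''pos h1
    rwa [Real.log_pow, Nat.cast_add, Nat.cast_one] at h2
  have hlt : (1 - ε) * (N'' : ℝ) < ((K : ℝ) + 1) * L := by
    rw [← hLL3] at hlog2
    have h3 : (1 - ε) * (N'' : ℝ) * Real.log 3 < ((K : ℝ) + 1) * L * Real.log 3 := by linarith
    exact lt_of_mul_lt_mul_right h3 hL3.le
  obtain ⟨hK1, hpay⟩ := hcore (N'' : ℝ) (K : ℝ) (Nat.cast_nonneg K) hN''B hlt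
  have hK1' : 1 ≤ K := by exact_mod_cast hK1
  obtain ⟨k, hk⟩ : ∃ k, K = k + 1 := ⟨K - 1, by omega⟩
  -- the honest cell `⟨m^K⟩³ ≤ cw₂^{⊠(N K + N'')}`
  have hcell : TensorRestrictsTo (kroneckerPow (cwTensor ℂ 2) (N * K + N''))
      (matMulTensor ℂ (m ^ K) (m ^ K) (m ^ K)) := by
    rw [hk]
    exact honest_of_assisted (assisted_pow hA k) hDres (hk ▸ hKle)
  refine ⟨N * K + N'', hN''N₀.trans (Nat.le_add_left _ _), m ^ K, hcell, ?_⟩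
  -- the pay-off `(N K + N'') log c ≤ 2 K log m`
  have hpay' : ((N : ℝ) * K + N'') * Real.log c ≤ 2 * (K * Real.log m) := by
    have e : (K : ℝ) * g = 2 * (K * Real.log m) - K * ((N : ℝ) + L) * Real.log c := by
      rw [hgdef]; ring
    nlinarith
  have hlhs : 0 < c ^ (N * K + N'') := pow_pos hcpos _
  have hrhs : (0 : ℝ) < ((m ^ K : ℕ) : ℝ) ^ 2 := by positivity
  rw [← Real.log_le_log_iff hlhs hrhs, Real.log_pow, Nat.cast_pow, Real.log_pow, Real.log_pow]
  push_cast
  linarith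

end Rate

end Summit.MatrixMultiplication.MatrixMultiplication.Theorems.OutsiderSandwichAssisted
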